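import Literature.IUT.HodgeTheaters.BadLocalFrobenioidOfKitsDTheta
import Literature.IUT.HodgeTheaters.BadLocalFrobenioidOfKitsWitness
import Mathlib.CategoryTheory.Limits.Preserves.Shapes.Terminal
import HarnessLib

/-!
# [IUTchI] Example 3.2 (vi) (a)(b) — NON-VACUITY of the anabelian binders `hΔ`, `hY` and the two clauses OUTRIGHT at
# an explicit GENUINE-PLACE datum: the degenerate group datum `Π_v̲ := G_v̲` (no covering) over `K_v̲ = K_w`

S. Mochizuki, *Inter-universal Teichmüller theory I*, kurims manuscript (May 2020), Example 3.2 (vi) p. 73, (a) "`D⊢_v ⊆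
D_v` may be reconstructed category-theoretically from `D_v`", (b) "the category `D^Θ_v` may be reconstructed
category-theoretically from `D_v`" [claim: Mochizuki2012, status: disputed] (D-0012 claim key, series status DISPUTED;
this file is a PROOF-ONLY composition; nothing of the series is asserted; no side is taken on [IUTchIII] Cor. 3.12).
Purpose (abc-iut-L5-lead gen 8 TOKEN STANDARD (b), RULINGS #110 (4): "every displayed DATA/LAW binder jointly
NON-VACUOUS at one explicit datum (model allowed, labelled)"): the closers of `BadLocalFrobenioidOfKitsDdash.lean`
(p489141) and `BadLocalFrobenioidOfKitsDTheta.lean` display two anabelian binders — `hΔ` («`Ker(Π_v ↠ G_v)` is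
characteristic», tempered [AbsAnab] Lem. 1.3.8) and `hY` («`Π_Ÿ` is carried onto a conjugate by every bicontinuous
automorphism») — and THIS FILE exhibits ONE explicit datum, built from the REAL initial Θ-data at a genuine bad place
`v̲ = w`, at which both binders hold and both clauses hold outright: abc-iut-L5-t2 (gen 6)'s DEGENERATE group datum
`BadLocalGroupDatum.trivial G_v̲` (`Π_v̲ := G_v̲ = Gal(K̄_w/K_w)`, `aug := id`, `Π_Ÿ := ⊤`; `BadLocalFrobenioidOfKitsWitness.lean`
p441995) with its degenerate tempered side `TemperedThetaInput.trivial` — LABEL «[model: no covering; X̲̲_v := Spec K_v]»,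
a witness of satisfiability of OUR typed binders, NOT evidence for print's tempered objects
[cite: Mochizuki2012, I Ex 3.2 (i)(v) pp.70-72].
* `BadLocalGroupDatum.forall_map_ker_trivial`, `forall_map_Y_trivial` — `hΔ` and `hY` HOLD at the degenerate datum
  (`Ker(id) = 1`, `Π_Ÿ = ⊤`), for every topological group `G`;
* `BadLocalGroupDatum.trivial_incl_reconstructibleAlong` — (a) at the degenerate datum for EVERY `G`, with NO temperedness
  / countability hypothesis: the pull-back along `id` is essentially surjective, full and faithful;
* `BadLocalGroupDatum.nonempty_iso_ydd_trivial` — `Ÿ_v = Π_v/⊤` is TERMINAL in `CosetCat G_v`, hence fixed up to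
  isomorphism by every self-equivalence; so (b) at the degenerate datum by `dThetaIncl_reconstructibleAlong_of_incl`
  (`trivial_dThetaIncl_reconstructibleAlong`);
* `BadLocalFrobenioid.ddashFromD_and_dThetaFromD_ofKits_trivial` and **`InitialThetaData.ex32vi_ab_badLocalFrobenioidAt_trivial`**
  — (vi)(a) ∧ (vi)(b) UNCONDITIONALLY at `ofKits … (BadLocalGroupDatum.trivial G_v) K` for every tempered-side input
  `K`, in particular at the GENUINE datum `D.badLocalFrobenioidAt hv w p hw (BadLocalGroupDatum.trivial _)
  (TemperedThetaInput.trivial _ _)` (`K_v̲ = K_w`, genuine `q_v̲`, `q̲_v̲`, `C⊢_v̲`; every input of the assembly inhabited),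
  together with the binders: `InitialThetaData.ex32vi_binders_badLocalFrobenioidAt_trivial`.
No new definition, instance or notation.  typed ≠ proved elsewhere; model ≠ genuine tempered datum; DISCHARGED here =
proved as typed under OUR kernel at the named datum.
-/

noncomputable section

namespace Literature.IUT.HodgeTheaters

open CategoryTheory CategoryTheory.Limits Literature.AnabelianGeometry.SemiGraphs Literature.AlgebraicGeometry.Frobenioids
open Literature.AlgebraicGeometry.Frobenioids.PadicFrd Topology

universe u

namespace BadLocalGroupDatum

variable (G : Type u) [Group G] [TopologicalSpace G]

/-! ### The binders at the degenerate datum -/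

/-- **`hΔ` HOLDS at the degenerate datum**: `Ker(aug) = Ker(id) = 1` is carried onto itself by every bicontinuous
automorphism. [claim: Mochizuki2012, status: disputed] -/
theorem forall_map_ker_trivial (φ : G ≃ₜ* G) :
    (trivial G).aug.ker.map φ.toMulEquiv.toMonoidHom = (trivial G).aug.ker :=
  (trivial G).forall_map_ker_of_injective (fun _ _ h => h) φ

/-- **`hY` HOLDS at the degenerate datum**: `Π_Ÿ = ⊤` is carried onto (a conjugate of) itself by every bicontinuous
automorphism. [claim: Mochizuki2012, status: disputed] -/
theorem forall_map_Y_trivial (φ : G ≃ₜ* G) :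
    ∃ c : G, ∀ g : G, g ∈ (trivial G).Y ↔ c⁻¹ * φ g * c ∈ (trivial G).Y :=
  ⟨1, fun _ => ⟨fun _ => OpenSubgroup.mem_top _, fun _ => OpenSubgroup.mem_top _⟩⟩

/-! ### (a) and (b) at the degenerate datum, for every topological group -/

/-- `D⊢_v ⊆ D_v` of the degenerate datum — the pull-back along `id` — is essentially surjective (every object is hit on
the nose). [claim: Mochizuki2012, status: disputed] -/
theorem trivial_incl_essSurj : (trivial G).incl.EssSurj where
  mem_essImage X := ⟨X, ⟨eqToIso (by
    apply CosetCat.ext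
    apply OpenSubgroup.toSubgroup_injective
    rfl)⟩⟩

/-- **(vi)(a) at the degenerate datum, UNCONDITIONALLY** (every topological group `G_v`, no temperedness/countability
input): `D⊢_v ⊆ D_v` is reconstructible from `D_v` because the inclusion is an equivalence onto its (whole) image.
[claim: Mochizuki2012, status: disputed] -/
theorem trivial_incl_reconstructibleAlong : ReconstructibleAlong (trivial G).incl := by
  haveI := (trivial G).incl_full
  haveI := (trivial G).incl_faithful
  haveI := trivial_incl_essSurj G
  exact reconstructibleAlong_of_essSurj _

/-- **`Ÿ_v` of the degenerate datum (`Π_v/⊤`, one point) is fixed up to isomorphism by every self-equivalence of `D_v`**: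
it is a TERMINAL object of `CosetCat G_v`, and equivalences preserve terminal objects. [claim: Mochizuki2012, status: disputed] -/
theorem nonempty_iso_ydd_trivial (e : (trivial G).Dv ≌ (trivial G).Dv) :
    Nonempty (e.functor.obj (trivial G).ydd ≅ (trivial G).ydd) := by
  -- `Ÿ_v = ⟨⊤⟩` is terminal: a unique morphism from every object (its point lives in the one-point space `G/⊤`)
  haveI hsub : Subsingleton ((trivial G).ydd.carrier) := by
    change Subsingleton (G ⧸ (⊤ : Subgroup G))
    exact QuotientGroup.subsingleton_quotient_top
  have hT : IsTerminal ((trivial G).ydd : CosetCat G) :=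
    IsTerminal.ofUniqueHom (fun X => CosetCat.homMk (((1 : G)) : (trivial G).ydd.carrier) fun _ _ => Subsingleton.elim _ _)
      fun X f => CosetCat.hom_ext (Subsingleton.elim _ _)
  exact ⟨(hT.isTerminalObj e.functor _).uniqueUpToIso hT⟩

/-- **(vi)(b) at the degenerate datum, UNCONDITIONALLY**: `D^Θ_v` is reconstructible from `D_v` — by
`dThetaIncl_reconstructibleAlong_of_incl` from (a) and the invariance of the terminal `Ÿ_v`.
[claim: Mochizuki2012, status: disputed] -/
theorem trivial_dThetaIncl_reconstructibleAlong :
    ReconstructibleAlong ((trivial G).dThetaIncl ⋙ Over.forget (trivial G).ydd) :=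
  (trivial G).dThetaIncl_reconstructibleAlong_of_incl (trivial_incl_reconstructibleAlong G) (nonempty_iso_ydd_trivial G)

end BadLocalGroupDatum

/-! ### At the assembly over the degenerate group datum -/

namespace BadLocalFrobenioid

variable {p : ℕ} [Fact p.Prime] (l : ℕ) (d : GaloisValDatum.{0} p) (q qroot : intNonzero d.k)
  (hpow : qroot ^ (2 * l) = q) (hq : ¬ IsUnit qroot)
  {Fv : Type} [Category.{0} Fv] {Fbirat : Type} [Category.{0} Fbirat] {Cv : Type} [Category.{0} Cv]
  (K : TemperedThetaInput d (BadLocalGroupDatum.trivial d.Gal) hq Fv Fbirat Cv)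

/-- **(vi)(a) ∧ (vi)(b) UNCONDITIONALLY for `ofKits` over the degenerate group datum `Π_v := G_v`** (every
`GaloisValDatum`, every tempered-side input over it). [claim: Mochizuki2012, status: disputed] -/
theorem ddashFromD_and_dThetaFromD_ofKits_trivial :
    (ofKits l d (BadLocalGroupDatum.trivial d.Gal) q qroot hpow hq K).DdashFromD ∧
      (ofKits l d (BadLocalGroupDatum.trivial d.Gal) q qroot hpow hq K).DThetaFromD :=
  ⟨BadLocalGroupDatum.trivial_incl_reconstructibleAlong d.Gal,
    BadLocalGroupDatum.trivial_dThetaIncl_reconstructibleAlong d.Gal⟩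

end BadLocalFrobenioid

/-! ### At the GENUINE datum `v̲ = w ∣ v ∈ V(F)^bad`, `K_v̲ = K_w`, over the degenerate group datum -/

section Datum

open NumberField IsDedekindDomain

variable {F K Fbar : Type} [Field F] [NumberField F] [Field K] [NumberField K] [Algebra F K]
  [Field Fbar] [Algebra F Fbar] [Algebra K Fbar] [IsScalarTower F K Fbar] {E : WeierstrassCurve F}
  [E.IsElliptic] {l : ℕ} {Pb : BadPlacePredicates K} (D : InitialThetaData F K Fbar E l Pb)
  {v : FinitePlace F} (hv : v ∈ D.VFbad) (w : HeightOneSpectrum (𝓞 K)) [w.asIdeal.LiesOver v.maximalIdeal.asIdeal]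
  (p : ℕ) [Fact p.Prime] (hw : ((p : ℕ) : 𝓞 K) ∈ w.asIdeal)

namespace InitialThetaData

/-- **(vi)(a) ∧ (vi)(b) UNCONDITIONALLY AT THE GENUINE DATUM over the degenerate group datum `Π_v̲ := G_v̲ = Gal(K̄_w/K_w)`**,
for every tempered-side input `Kt` over it («[model: no covering]»; genuine `K_v̲ = K_w`, `q_v̲`, `q̲_v̲`, `C⊢_v̲`).
[claim: Mochizuki2012, status: disputed] -/
theorem ex32vi_ab_badLocalFrobenioidAt_trivial' {Fv : Type} [Category.{0} Fv] {Fbirat : Type} [Category.{0} Fbirat]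
    {Cv : Type} [Category.{0} Cv]
    (Kt : TemperedThetaInput (GaloisValDatum.ofPlace K p w hw) (BadLocalGroupDatum.trivial _)
      (D.qRootAt_not_isUnit hv w p hw) Fv Fbirat Cv) :
    (D.badLocalFrobenioidAt hv w p hw (BadLocalGroupDatum.trivial _) Kt).DdashFromD ∧
      (D.badLocalFrobenioidAt hv w p hw (BadLocalGroupDatum.trivial _) Kt).DThetaFromD :=
  BadLocalFrobenioid.ddashFromD_and_dThetaFromD_ofKits_trivial l _ _ _ _ _ Kt

/-- **(vi)(a) ∧ (vi)(b) AT ONE EXPLICIT, FULLY INHABITED GENUINE-PLACE DATUM**: the assembly at `K_v̲ = K_w` over the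
degenerate group datum with abc-iut-L5-t2's degenerate tempered side `TemperedThetaInput.trivial` (`F̲_v := C^Θ_v̲`,
`Θ̲_v := 1`; every field of every input inhabited) — «[model: no covering]».  This is the datum at which the binders of
the conditional closers are exhibited jointly (`ex32vi_binders_badLocalFrobenioidAt_trivial`). [claim: Mochizuki2012, status: disputed] -/
theorem ex32vi_ab_badLocalFrobenioidAt_trivial :
    (D.badLocalFrobenioidAt hv w p hw (BadLocalGroupDatum.trivial _)
        (TemperedThetaInput.trivial (GaloisValDatum.ofPlace K p w hw) (D.qRootAt_not_isUnit hv w p hw))).DdashFromD ∧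
      (D.badLocalFrobenioidAt hv w p hw (BadLocalGroupDatum.trivial _)
        (TemperedThetaInput.trivial (GaloisValDatum.ofPlace K p w hw) (D.qRootAt_not_isUnit hv w p hw))).DThetaFromD :=
  D.ex32vi_ab_badLocalFrobenioidAt_trivial' hv w p hw _

omit [w.asIdeal.LiesOver v.maximalIdeal.asIdeal] in
/-- **The two anabelian binders `hΔ`, `hY` of the conditional closers HOLD JOINTLY at that datum's group datum**
(`Π_v̲ := Gal(K̄_w/K_w)`, `aug = id`, `Π_Ÿ = ⊤`) — TOKEN STANDARD (b): binders jointly non-vacuous at one explicit datum,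
labelled «[model: no covering]». [claim: Mochizuki2012, status: disputed] -/
theorem ex32vi_binders_badLocalFrobenioidAt_trivial :
    (∀ φ : (GaloisValDatum.ofPlace K p w hw).Gal ≃ₜ* (GaloisValDatum.ofPlace K p w hw).Gal,
        (BadLocalGroupDatum.trivial (GaloisValDatum.ofPlace K p w hw).Gal).aug.ker.map φ.toMulEquiv.toMonoidHom =
          (BadLocalGroupDatum.trivial (GaloisValDatum.ofPlace K p w hw).Gal).aug.ker) ∧
      ∀ φ : (GaloisValDatum.ofPlace K p w hw).Gal ≃ₜ* (GaloisValDatum.ofPlace K p w hw).Gal,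
        ∃ c, ∀ g, g ∈ (BadLocalGroupDatum.trivial (GaloisValDatum.ofPlace K p w hw).Gal).Y ↔
          c⁻¹ * φ g * c ∈ (BadLocalGroupDatum.trivial (GaloisValDatum.ofPlace K p w hw).Gal).Y :=
  ⟨BadLocalGroupDatum.forall_map_ker_trivial _, BadLocalGroupDatum.forall_map_Y_trivial _⟩

end InitialThetaData

end Datum

end Literature.IUT.HodgeTheaters

end
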